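import Literature.Topology.FourManifolds.HandlebodyKernelExtensionBased
import Literature.Topology.FourManifolds.HandlebodyAutRealisation
import Literature.AlgebraicTopology.FundamentalGroup.MapOfEqRange
import HarnessLib

/-!
# Griffiths' handlebody extension theorem: reduction to boundary diffeomorphisms acting as the
# identity on `π₁` of the handlebody (the "Torelli" criterion)

Topic `Literature/Topology/FourManifolds`; a further file on the named fact
`Literature.Topology.FourManifolds.GriffithsExtension` (`HandlebodyKernelExtension.lean`;
H. B. Griffiths, *Automorphisms of a 3-dimensional handlebody* (1964), main theorem; S. Hensel,
*A primer on handlebody groups* (2020), Cor. 5.11), after `HandlebodyKernelExtensionModel.lean`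
(one model per genus), `HandlebodyKernelExtensionBased.lean` (based diffeomorphisms) and
`HandlebodyAutRealisation.lean` (every automorphism of `π₁(V, z)`, `z ∈ ∂V`, is induced by a
self-diffeomorphism of the handlebody `V` fixing `z` — Zieschang 1964 / Griffiths 1964 §§3–5, by
Laudenbach–Poénaru's handle slides).  **Everything here is proved; no definition and no named
fact is introduced; the fact is NOT discharged.**

Griffiths' criterion splits classically into two halves (Griffiths (1964), §§3–6;
McCullough–Miller, Mem. AMS 344 (1986), §1; Hensel (2020), §§5–6): (R) the handlebody group
surjects onto `Aut π₁ V` — the realisation half, now a theorem of the tree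
(`IsHandlebody.exists_diffeomorph_mapOfEq_eq`) — and (T) its "Torelli part": **a based
self-diffeomorphism `ψ` of `∂V` whose induced map, followed by `π₁(∂V, z₀) → π₁(V, z₀)`, equals
`π₁(∂V, z₀) → π₁(V, z₀)` (i.e. `ψ` acts as the identity on `π₁ V`) extends over `V`** (Luft's
twist group together with the meridian discs of Dehn's lemma; in genus `1` this is hypothesis (E)
of `TorusMappingClassFaithfulModel.lean`, proved in the tree by the homothety cover).  This file
proves the reduction of the whole criterion to (T):

* §1 `MulEquiv.exists_mulEquiv_comp_eq_of_surjective_of_map_ker_eq` — an automorphism `α` of a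
  group `A` stabilising the kernel of an epimorphism `π : A ↠ B` descends to an automorphism `θ`
  of `B` with `θ ∘ π = π ∘ α` (`QuotientGroup.congr`).  (The kernel condition of the fact, read at
  a fixed point `ψ z₀ = z₀` — `ψ_# = mapOfEq ψ _` stabilises `ker (π₁(∂V, z₀) → π₁ V)` — is
  `map_ker_mapOfEq_eq` of `HandlebodyKernelExtensionGenusOne.lean`.)
* §2 `IsHandlebody.diffeoExtends_of_map_ker_eq_ker_of_torelli` — **(T) at `z₀` implies Griffiths'
  based criterion at `z₀`**, for every genus-`g` handlebody `H` (subtype boundary datum) and every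
  `z₀ ∈ ∂H`: `π₁(∂H, z₀) → π₁(H, z₀)` is onto (`HasHandleDecomposition.surjective_inclHom_boundary`),
  so a kernel-preserving based `ψ` induces `θ ∈ Aut π₁(H, z₀)`; realise `θ⁻¹` by `G : H ≅ H`
  fixing `z₀` (`IsHandlebody.exists_diffeomorph_mapOfEq_eq`); then `∂G ∘ ψ` is based and acts as
  the identity on `π₁ H`, so extends by (T), and `ψ = (∂G ∘ ψ) ∘ ∂G⁻¹` extends.
* §3 `griffithsExtension_of_forall_diffeoExtends_of_flower_torelli` — **`GriffithsExtension` from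
  the genus-one input `h₁` of `griffithsExtension_of_forall_diffeoExtends_of_flower_based` and (T)
  for the flower handlebodies `FlowerModel.FlowerHandlebody hg`, `g ≥ 2`, at the north pole.**
  (The genus-one input is discharged in `Summits/…/Theorems`, where the homothety-cover proof
  lives; the remaining hypothesis is (T) for the flower handlebodies.)

## References

* H. B. Griffiths, *Automorphisms of a 3-dimensional handlebody*, Abh. Math. Sem. Univ. Hamburg 26
  (1964) 191–210, main theorem and §§3–6. [GriffithsHB1964Handlebody]
* S. Hensel, *A primer on handlebody groups*, Handbook of Group Actions V (2020), Cor. 5.11,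
  Thm. 6.2. [Hensel2020HandlebodyPrimer]
* E. Luft, *Actions of the homeotopy group of an orientable 3-dimensional handlebody*, Math. Ann.
  234 (1978) 279–292, Thm. 2.3. [Luft1978]
* A. Hatcher, *Algebraic Topology* (2002), §1.1 (p. 34). [HatcherAT2002]
-/

open scoped Manifold ContDiff Topology
open Set Function

noncomputable section

namespace Literature.Topology.FourManifolds

open BoundaryManifold Literature.AlgebraicTopology Literature.AlgebraicTopology.FundamentalGroup

universe u

/-! ### §1 Algebra and base-point bookkeeping -/

section Algebra

/-- **An automorphism stabilising the kernel of an epimorphism descends.**  If `π : A →* B` is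
onto and `α ∈ Aut A` satisfies `α(ker π) = ker π`, there is `θ ∈ Aut B` with `θ (π a) = π (α a)`
(`B ≅ A ⧸ ker π`, and `α` induces an automorphism of the quotient, `QuotientGroup.congr`).
[folklore] -/
theorem MulEquiv.exists_mulEquiv_comp_eq_of_surjective_of_map_ker_eq {A B : Type*} [Group A]
    [Group B] (π : A →* B) (hπ : Function.Surjective π) (α : A ≃* A)
    (hα : (π.ker).map α.toMonoidHom = π.ker) :
    ∃ θ : B ≃* B, ∀ a, θ (π a) = π (α a) := by
  let e₁ : A ⧸ π.ker ≃* B := QuotientGroup.quotientKerEquivOfSurjective π hπ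
  let e₂ : A ⧸ π.ker ≃* A ⧸ π.ker := QuotientGroup.congr π.ker π.ker α (by
    rw [← MulEquiv.toMonoidHom_eq_coe]; exact hα)
  have he₁ : ∀ a, e₁ (QuotientGroup.mk a) = π a := fun a => QuotientGroup.kerLift_mk π a
  refine ⟨e₁.symm.trans (e₂.trans e₁), fun a => ?_⟩
  have h1 : e₁.symm (π a) = QuotientGroup.mk a := by
    rw [MulEquiv.symm_apply_eq, he₁]
  rw [MulEquiv.trans_apply, MulEquiv.trans_apply, h1, QuotientGroup.congr_mk, he₁]

end Algebra

/-! ### §2 (T) at a boundary point implies Griffiths' based criterion at that point -/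

section Torelli

variable {g : ℕ} {H : Type u} [TopologicalSpace H] [T2Space H] [SecondCountableTopology H]
  [ChartedSpace (EuclideanHalfSpace 3) H] [IsManifold (𝓡∂ 3) ∞ H]

/-- **`π₁(∂H, z₀) → π₁(H, z₀)` is onto for a handlebody** (`Mathlib`'s `FundamentalGroup.map` of
the inclusion of the subtype boundary datum), from
`HasHandleDecomposition.surjective_inclHom_boundary` (Milnor's dual handles, `n ≥ 2`); the
continuous map is `⟨(boundaryData 2 H).incl, (boundaryData 2 H).continuous_incl⟩`, the form in
which the fact `GriffithsExtension` is stated. [cite: HatcherAT2002, Prop. 1.26] -/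
theorem IsHandlebody.surjective_map_boundaryData_incl (hH : IsHandlebody g H)
    (z₀ : (𝓡∂ 3).boundary H) :
    Function.Surjective (FundamentalGroup.map
      (⟨(BoundaryManifold.boundaryData 2 H).incl, (BoundaryManifold.boundaryData 2 H).continuous_incl⟩ : C((𝓡∂ 3).boundary H, H)) z₀) := by
  haveI := hH.compactSpace
  haveI := hH.connectedSpace
  have hs := hH.hasHandleDecomposition.surjective_inclHom_boundary (handleCount_zero 1 g)
    (fun j hj => handleCount_of_two_le 1 g hj) le_rfl (w := (z₀ : H)) z₀.2
  intro c
  obtain ⟨a, ha⟩ := hs c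
  refine ⟨a, ?_⟩
  rw [← mapOfEq_rfl_apply]
  exact ha

/-- **(T) implies Griffiths' based criterion.**  Let `H` be a genus-`g` handlebody with its
subtype boundary datum `b` and `z₀ ∈ ∂H`.  Suppose (T): every self-diffeomorphism `χ` of `∂H`
fixing `z₀` with `incl_# ∘ χ_# = incl_#` on `π₁(∂H, z₀)` extends over `H`.  Then every
self-diffeomorphism `ψ` of `∂H` fixing `z₀` whose induced map carries `ker (π₁(∂H, z₀) → π₁ H)`
onto `ker (π₁(∂H, ψ z₀) → π₁ H)` extends over `H`: `ψ_#` stabilises the kernel of the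
epimorphism `π₁(∂H, z₀) ↠ π₁(H, z₀)`, so induces `θ ∈ Aut π₁(H, z₀)`; by the realisation theorem
(`IsHandlebody.exists_diffeomorph_mapOfEq_eq`) `θ⁻¹ = G_#` for a self-diffeomorphism `G` of `H`
fixing `z₀`; `∂G ∘ ψ` then acts as the identity on `π₁ H` and extends by (T), and
`ψ = (∂G ∘ ψ) ∘ ∂G⁻¹`.  (Griffiths (1964), §6: the extension criterion from the realisation of
`Aut F_g` and the structure of the kernel.)
[cite: GriffithsHB1964Handlebody, main theorem and §6] [cite: Hensel2020HandlebodyPrimer, Cor. 5.11 and Thm. 6.2] -/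
theorem IsHandlebody.diffeoExtends_of_map_ker_eq_ker_of_torelli (hH : IsHandlebody g H)
    (z₀ : (𝓡∂ 3).boundary H)
    (hT : ∀ (χ : (𝓡∂ 3).boundary H ≃ₘ⟮𝓡 2, 𝓡 2⟯ (𝓡∂ 3).boundary H) (hχ : χ z₀ = z₀),
      (∀ a : FundamentalGroup ((𝓡∂ 3).boundary H) z₀,
        FundamentalGroup.map
            (⟨(BoundaryManifold.boundaryData 2 H).incl, (BoundaryManifold.boundaryData 2 H).continuous_incl⟩ : C((𝓡∂ 3).boundary H, H)) z₀
            (FundamentalGroup.mapOfEq (⟨χ, χ.continuous⟩ : C(_, _)) hχ a) =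
          FundamentalGroup.map
            (⟨(BoundaryManifold.boundaryData 2 H).incl, (BoundaryManifold.boundaryData 2 H).continuous_incl⟩ : C((𝓡∂ 3).boundary H, H)) z₀ a) →
      (BoundaryManifold.boundaryData 2 H).DiffeoExtends χ)
    (ψ : (𝓡∂ 3).boundary H ≃ₘ⟮𝓡 2, 𝓡 2⟯ (𝓡∂ 3).boundary H) (hψ : ψ z₀ = z₀)
    (hker : ((FundamentalGroup.map
        (⟨(BoundaryManifold.boundaryData 2 H).incl, (BoundaryManifold.boundaryData 2 H).continuous_incl⟩ : C((𝓡∂ 3).boundary H, H)) z₀).ker).map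
        (FundamentalGroup.map (⟨ψ, ψ.continuous⟩ : C(_, _)) z₀)
      = (FundamentalGroup.map
          (⟨(BoundaryManifold.boundaryData 2 H).incl, (BoundaryManifold.boundaryData 2 H).continuous_incl⟩ : C((𝓡∂ 3).boundary H, H))
          ((⟨ψ, ψ.continuous⟩ : C(_, _)) z₀)).ker) :
    (BoundaryManifold.boundaryData 2 H).DiffeoExtends ψ := by
  set ι : C((𝓡∂ 3).boundary H, H) :=
    (⟨(BoundaryManifold.boundaryData 2 H).incl, (BoundaryManifold.boundaryData 2 H).continuous_incl⟩ : C((𝓡∂ 3).boundary H, H)) with hι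
  set b : BoundaryData (𝓡∂ 3) H (𝓡 2) := BoundaryManifold.boundaryData 2 H with hb
  set πH : FundamentalGroup ((𝓡∂ 3).boundary H) z₀ →* FundamentalGroup H (ι z₀) :=
    FundamentalGroup.map ι z₀ with hπH
  have hsurj : Function.Surjective πH := by rw [hπH, hι]; exact hH.surjective_map_boundaryData_incl z₀
  -- `ψ_#` as an automorphism of `π₁(∂H, z₀)` stabilising `ker πH`
  let ψCM : C((𝓡∂ 3).boundary H, (𝓡∂ 3).boundary H) := ⟨ψ, ψ.continuous⟩
  obtain ⟨α, hα⟩ := exists_mulAut_apply_eq_mapOfEq ψ hψ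
  have hαe : α.toMonoidHom = FundamentalGroup.mapOfEq ψCM hψ := MonoidHom.ext fun c => hα c
  have hαker : (πH.ker).map α.toMonoidHom = πH.ker := by
    rw [hαe]
    exact map_ker_mapOfEq_eq ι ψCM hψ hker
  -- the induced automorphism `θ` of `π₁(H, z₀)` and a diffeomorphism `G` realising `θ⁻¹`
  obtain ⟨θ, hθ⟩ := MulEquiv.exists_mulEquiv_comp_eq_of_surjective_of_map_ker_eq πH hsurj α hαker
  obtain ⟨G, hGz, hG⟩ := hH.exists_diffeomorph_mapOfEq_eq (ι z₀) z₀.2 θ.symm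
  -- its restriction `φ = ∂G` to the boundary
  set φ : (𝓡∂ 3).boundary H ≃ₘ⟮𝓡 2, 𝓡 2⟯ (𝓡∂ 3).boundary H := b.restrictDiffeomorph b G with hφ
  have hφincl : ∀ w, ι (φ w) = G (ι w) := fun w =>
    BoundaryData.incl_restrictDiffeomorph (b₁ := b) (b₂ := b) G w
  have hφz : φ z₀ = z₀ := b.injective_incl (by
    show ι (φ z₀) = ι z₀
    rw [hφincl, hGz])
  have hφext : b.DiffeoExtends φ := ⟨G, funext fun w => (hφincl w).symm⟩
  let φCM : C((𝓡∂ 3).boundary H, (𝓡∂ 3).boundary H) := ⟨φ, φ.continuous⟩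
  let GCM : C(H, H) := ⟨G, G.continuous⟩
  -- naturality: `πH ∘ φ_# = G_# ∘ πH`
  have hnat : ∀ a, πH (FundamentalGroup.mapOfEq φCM hφz a) =
      FundamentalGroup.mapOfEq GCM hGz (πH a) := fun a => by
    have hcomp : ι.comp φCM = GCM.comp ι := ContinuousMap.ext fun w => hφincl w
    rw [hπH, ← mapOfEq_rfl_apply ι z₀, ← mapOfEq_rfl_apply ι z₀,
      ← FundamentalGroup.mapOfEq_comp_apply φCM ι hφz rfl a,
      FundamentalGroup.mapOfEq_congr hcomp,
      ← FundamentalGroup.mapOfEq_comp_apply ι GCM rfl hGz a]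
  -- `χ = φ ∘ ψ` is based and acts as the identity on `π₁ H`
  have hχz : (ψ.trans φ) z₀ = z₀ := by
    show φ (ψ z₀) = z₀
    rw [hψ, hφz]
  have hχ : ∀ a : FundamentalGroup ((𝓡∂ 3).boundary H) z₀,
      πH (FundamentalGroup.mapOfEq (⟨ψ.trans φ, (ψ.trans φ).continuous⟩ : C(_, _)) hχz a) = πH a := by
    intro a
    rw [← mapOfEq_trans φ ψ hφz hψ a]
    show πH (FundamentalGroup.mapOfEq φCM hφz (FundamentalGroup.mapOfEq ψCM hψ a)) = πH a
    rw [hnat, hG, ← hα a, ← hθ a, MulEquiv.symm_apply_apply]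
  have hχext : b.DiffeoExtends (ψ.trans φ) := hT (ψ.trans φ) hχz hχ
  -- `ψ = (φ ∘ ψ) ∘ φ⁻¹`
  have h' : b.DiffeoExtends ((ψ.trans φ).trans φ.symm) := hχext.trans hφext.symm
  have e : (ψ.trans φ).trans φ.symm = ψ := Diffeomorph.ext fun w => by
    simp only [Diffeomorph.coe_trans, Function.comp_apply, Diffeomorph.symm_apply_apply]
  rw [← e]
  exact h'

end Torelli

/-! ### §3 `GriffithsExtension` from the genus-one input and (T) for the flower handlebodies -/

open RoundSolidTorusModel FlowerModel in
/-- **`GriffithsExtension` from the genus-one input and the Torelli criterion (T) on the flower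
handlebodies.**  It suffices that (genus `1`) Griffiths' kernel criterion hold on the Heegaard
torus of the round solid torus (hypothesis `h₁`, verbatim that of
`griffithsExtension_of_forall_diffeoExtends_of_flower_based`; discharged in the tree's
`Summits/…/Theorems` by the homothety-cover proof) and that (T) for every `g ≥ 2`, every
self-diffeomorphism `χ` of the flower surface `∂V_g` fixing the north pole `x₀` and acting as the
identity on `π₁(V_g, x₀)` — `incl_# (χ_# a) = incl_# a` for all `a ∈ π₁(∂V_g, x₀)` — extend over
`V_g = FlowerModel.FlowerHandlebody hg`: by §2 (T) gives the based flower criterion `h₂`.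
[cite: GriffithsHB1964Handlebody, main theorem] [cite: Hensel2020HandlebodyPrimer, Cor. 5.11 and Thm. 6.2] -/
theorem griffithsExtension_of_forall_diffeoExtends_of_flower_torelli
    (h₁ : ∀ (χ : (𝓡∂ 3).boundary RoundSolidTorus ≃ₘ⟮𝓡 2, 𝓡 2⟯ (𝓡∂ 3).boundary RoundSolidTorus)
      (y₀ : (𝓡∂ 3).boundary RoundSolidTorus),
      ((FundamentalGroup.map bdryIncl y₀).ker).map
          (FundamentalGroup.map (⟨χ, χ.continuous⟩ : C(_, _)) y₀)
        = (FundamentalGroup.map bdryIncl ((⟨χ, χ.continuous⟩ : C(_, _)) y₀)).ker →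
      (BoundaryManifold.boundaryData 2 RoundSolidTorus).DiffeoExtends χ)
    (hT : ∀ (g : ℕ) (hg : 2 ≤ g)
      (χ : (𝓡∂ 3).boundary (FlowerHandlebody hg) ≃ₘ⟮𝓡 2, 𝓡 2⟯ (𝓡∂ 3).boundary (FlowerHandlebody hg))
      (hχ : χ (northPole hg) = northPole hg),
      (∀ a : FundamentalGroup ((𝓡∂ 3).boundary (FlowerHandlebody hg)) (northPole hg),
        FundamentalGroup.map (⟨(BoundaryManifold.boundaryData 2 (FlowerHandlebody hg)).incl,
            (BoundaryManifold.boundaryData 2 (FlowerHandlebody hg)).continuous_incl⟩ :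
              C((𝓡∂ 3).boundary (FlowerHandlebody hg), FlowerHandlebody hg)) (northPole hg)
            (FundamentalGroup.mapOfEq (⟨χ, χ.continuous⟩ : C(_, _)) hχ a) =
          FundamentalGroup.map (⟨(BoundaryManifold.boundaryData 2 (FlowerHandlebody hg)).incl,
            (BoundaryManifold.boundaryData 2 (FlowerHandlebody hg)).continuous_incl⟩ :
              C((𝓡∂ 3).boundary (FlowerHandlebody hg), FlowerHandlebody hg)) (northPole hg) a) →
      (BoundaryManifold.boundaryData 2 (FlowerHandlebody hg)).DiffeoExtends χ) :
    GriffithsExtension :=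
  griffithsExtension_of_forall_diffeoExtends_of_flower_based h₁ fun g hg ψ hψ hker =>
    (isHandlebody_flowerHandlebody hg).diffeoExtends_of_map_ker_eq_ker_of_torelli (northPole hg)
      (hT g hg) ψ hψ hker

/-! ### §4 Model-free form: (T) on ANY one genus-`g` handlebody per `g ≥ 2` suffices -/

open RoundSolidTorusModel FlowerModel in
/-- **`GriffithsExtension` from the genus-one input and the Torelli criterion (T) on one
arbitrary model per genus `g ≥ 2`.**  For each `g ≥ 2` it suffices to exhibit SOME genus-`g`
handlebody `H₀` (`IsHandlebody g H₀`) and SOME point `z₀ ∈ ∂H₀` such that every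
self-diffeomorphism `χ` of `∂H₀` (subtype boundary datum) fixing `z₀` and acting as the identity
on `π₁(H₀, z₀)` extends over `H₀`: by §2, (T) at `z₀` gives Griffiths' based criterion at `z₀`,
by `BoundaryData.diffeoExtends_of_map_ker_eq_ker_of_based` (connected boundary,
`IsHandlebody.connectedSpace_boundary_holds`) the criterion at every base point of that datum,
and `griffithsExtension_of_models` (the classification of handlebodies) transports it to every
genus-`g` handlebody and boundary datum; genus `1` is the input `h₁` on the round solid torus.
This frees the residual obligation of the fact from the explicit flower model: it may be
discharged on whatever genus-`g` handlebody is most convenient (e.g. one carrying chosen Morse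
data). [cite: GriffithsHB1964Handlebody, main theorem and §§3–6] [cite: Hensel2020HandlebodyPrimer, Cor. 5.11 and Thm. 6.2] -/
theorem griffithsExtension_of_forall_exists_torelli_model
    (h₁ : ∀ (χ : (𝓡∂ 3).boundary RoundSolidTorus ≃ₘ⟮𝓡 2, 𝓡 2⟯ (𝓡∂ 3).boundary RoundSolidTorus)
      (y₀ : (𝓡∂ 3).boundary RoundSolidTorus),
      ((FundamentalGroup.map bdryIncl y₀).ker).map
          (FundamentalGroup.map (⟨χ, χ.continuous⟩ : C(_, _)) y₀)
        = (FundamentalGroup.map bdryIncl ((⟨χ, χ.continuous⟩ : C(_, _)) y₀)).ker →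
      (BoundaryManifold.boundaryData 2 RoundSolidTorus).DiffeoExtends χ)
    (hT : ∀ g : ℕ, 2 ≤ g → ∃ (H₀ : Type) (_ : TopologicalSpace H₀) (_ : T2Space H₀)
      (_ : SecondCountableTopology H₀) (_ : ChartedSpace (EuclideanHalfSpace 3) H₀)
      (_ : IsManifold (𝓡∂ 3) ∞ H₀) (_ : IsHandlebody g H₀) (z₀ : (𝓡∂ 3).boundary H₀),
      ∀ (χ : (𝓡∂ 3).boundary H₀ ≃ₘ⟮𝓡 2, 𝓡 2⟯ (𝓡∂ 3).boundary H₀) (hχ : χ z₀ = z₀),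
        (∀ a : FundamentalGroup ((𝓡∂ 3).boundary H₀) z₀,
          FundamentalGroup.map
              (⟨(BoundaryManifold.boundaryData 2 H₀).incl,
                (BoundaryManifold.boundaryData 2 H₀).continuous_incl⟩ : C((𝓡∂ 3).boundary H₀, H₀)) z₀
              (FundamentalGroup.mapOfEq (⟨χ, χ.continuous⟩ : C(_, _)) hχ a) =
            FundamentalGroup.map
              (⟨(BoundaryManifold.boundaryData 2 H₀).incl,
                (BoundaryManifold.boundaryData 2 H₀).continuous_incl⟩ : C((𝓡∂ 3).boundary H₀, H₀)) z₀ a) →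
        (BoundaryManifold.boundaryData 2 H₀).DiffeoExtends χ) :
    GriffithsExtension := by
  refine griffithsExtension_of_models fun g hg => ?_
  rcases Nat.lt_or_ge g 2 with hg1 | hg2
  · -- genus `1`: the round solid torus
    obtain rfl : g = 1 := by omega
    exact ⟨RoundSolidTorus, inferInstance, inferInstance, inferInstance, inferInstance, inferInstance,
      isHandlebody_one_roundSolidTorus, BoundaryManifold.boundaryData 2 RoundSolidTorus,
      fun χ y₀ hker => h₁ χ y₀ hker⟩
  · -- genus `≥ 2`: the given model, (T) at `z₀` ⇒ based criterion at `z₀` ⇒ criterion everywhere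
    obtain ⟨H₀, _, _, _, _, _, hH₀, z₀, hz₀⟩ := hT g hg2
    haveI := hH₀.compactSpace
    haveI : ConnectedSpace (BoundaryManifold.boundaryData 2 H₀).carrier :=
      IsHandlebody.connectedSpace_boundary_holds g H₀ hH₀ (BoundaryManifold.boundaryData 2 H₀)
    refine ⟨H₀, inferInstance, inferInstance, inferInstance, inferInstance, inferInstance, hH₀,
      BoundaryManifold.boundaryData 2 H₀, fun χ y₀ hker => ?_⟩
    exact (BoundaryManifold.boundaryData 2 H₀).diffeoExtends_of_map_ker_eq_ker_of_based z₀
      (fun ψ hψ hk => hH₀.diffeoExtends_of_map_ker_eq_ker_of_torelli z₀ hz₀ ψ hψ hk) χ y₀ hker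

end Literature.Topology.FourManifolds

end
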